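import Literature.MathematicalPhysics.QuantumFieldTheory.OSData
import Literature.MathematicalPhysics.QuantumFieldTheory.OSReconstructionNoE1Proofs
import Literature.MathematicalPhysics.QuantumLattice.SchwingerOSPositivity
import Literature.MathematicalPhysics.QuantumLattice.SchwartzTranslationCutoff
import Literature.MathematicalPhysics.QuantumLattice.RandomField
import HarnessLib

/-!
# Route `BoundedSkewnessRunning`, support item S2 `WindowFromNontriviality` (stmt-QuantumFields-19899) — helper:
# the TRUNCATED one-point vectors of the E1-free Osterwalder–Schrader reconstruction

For OS data `T`, the E1-free reconstruction `h : OSReconstructionNoE1 T.schwinger` of the tree has a vacuum `Ω`, one-point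
field vectors `Ψ_X` (time-ordered `X`), the contraction semigroup `e^{-tH}` and joint spectral measures.  The TRUNCATED
vector `ψ_X := Ψ_X − ⟪Ω, Ψ_X⟫ Ω` carries the truncated two-point Schwinger function: `inner_trunc_trunc`
(`⟪ψ_X, ψ_Y⟫ = 𝔖₂(ΘX* ⊗ Y) − conj 𝔖₁(X)·𝔖₁(Y)`), `schwingerTrunc_self_eq_norm_sq` (`𝔖₂(ΘY* ⊗ Y) − 𝔖₁(ΘY*)𝔖₁(Y) = ‖ψ_Y‖²`),
`transfer_trunc` (`e^{-tH}ψ_X = ψ_{X_t}`), `trunc_translate_ne_zero` (`e^{-tH}` is injective — Laplace transform of the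
joint spectral measure; the tree's `OSTimeAxisNullVector` argument re-derived inline, that module not building on the farm),
`exists_trunc_ne_zero` (**non-triviality ⇒ a REAL, compactly supported, positive-time `w` with `ψ_w ≠ 0`**: real and
imaginary parts, smooth cut-offs, continuity of `Y ↦ ⟪ψ_F, ψ_Y⟫`), and the export `exists_realTest_window_data` (for every
time shift `t ≥ 0` the truncated value `𝔖₂(θw_t ⊗ w_t) − 𝔖₁(θw_t)𝔖₁(w_t)`, through off-diagonal tensor witnesses ready for
`IsYangMillsFor`, has positive real part `‖e^{-tH}ψ_w‖²`).  No summit, leg or crux statement is proved.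

References: Osterwalder–Schrader, CMP 31 (1973) §4.1; Glimm–Jaffe, Thm. 6.1.3; Reed–Simon I, Thm. VIII.12.
-/

set_option autoImplicit false

noncomputable section

open MeasureTheory Filter Topology
open scoped InnerProductSpace SchwartzMap ComplexOrder ComplexConjugate
open Literature.MathematicalPhysics.AQFT Literature.MathematicalPhysics.QuantumLattice
open Literature.MathematicalPhysics.QuantumLattice.SchwingerFamily (timeVec)

namespace Summit.QuantumFields.YangMills.Theorems.WindowFromNontriviality

open Literature.MathematicalPhysics.QuantumFieldTheory
open Literature.MathematicalPhysics.QuantumFieldTheory.OSReconstructionNoE1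

universe u

variable {ι : Type u} {d : ℕ} [NeZero d] {S : LabelledSchwingerFamily ι (EuclideanSpace ℝ (Fin d))}
  (h : OSReconstructionNoE1 S)

/-- The label string `(∅ reversed) ++ k` on `Fin (0 + 1)` is the constant string. [folklore] -/
theorem append_elim0_const (s : ι) :
    Fin.append (Fin.elim0 ∘ Fin.rev) (fun _ : Fin 1 => s) = fun _ : Fin (0 + 1) => s := by
  funext i
  refine Fin.addCases (fun j => j.elim0) (fun j => ?_) i
  exact Fin.append_right _ _ j

/-- `Θ1* ⊗ X = X` for the vacuum generator `1 ∈ 𝓢((ℝ^d)⁰)`. [folklore] -/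
theorem appendTensor_osAdjoint_const_one (X : 𝓢((Fin 1 → EuclideanSpace ℝ (Fin d)), ℂ)) :
    SchwartzMap.appendTensor (osAdjoint (SchwartzMap.constOfSubsingleton (D := Fin 0 → EuclideanSpace ℝ (Fin d)) 1))
      X = X := by
  ext x
  rw [SchwartzMap.appendTensor_apply, osAdjoint_apply, SchwartzMap.constOfSubsingleton_apply, map_one, one_mul]
  congr 1
  funext i
  simp

/-- **`⟪Ω, Ψ_X⟫ = 𝔖₁(X)`** for a time-ordered one-point `X`. [cite: OsterwalderSchraderCMP1973, §4.1] -/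
theorem inner_vacuum_fieldVec (s : ι) (X : 𝓢((Fin 1 → EuclideanSpace ℝ (Fin d)), ℂ)) (hX : IsTimeOrdered X) :
    ⟪h.vacuum, h.fieldVec 1 (fun _ => s) X hX⟫_ℂ = S 1 (fun _ => s) X := by
  have hvac : h.vacuum = h.fieldVec 0 Fin.elim0 (SchwartzMap.constOfSubsingleton 1)
      isTimeOrdered_constOfSubsingleton := rfl
  rw [hvac, h.inner_fieldVec_fieldVec Fin.elim0 (fun _ => s) isTimeOrdered_constOfSubsingleton hX
    (isAppendTensorOf_appendTensor _ _), appendTensor_osAdjoint_const_one, append_elim0_const]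

/-- **`⟪Ψ_X, Ψ_Y⟫ = 𝔖₂(ΘX* ⊗ Y)`** for time-ordered one-point `X, Y` (constant labels). [cite: OsterwalderSchraderCMP1973, §4.1] -/
theorem inner_fieldVec_one_one (s : ι) (X Y : 𝓢((Fin 1 → EuclideanSpace ℝ (Fin d)), ℂ)) (hX : IsTimeOrdered X)
    (hY : IsTimeOrdered Y) :
    ⟪h.fieldVec 1 (fun _ => s) X hX, h.fieldVec 1 (fun _ => s) Y hY⟫_ℂ =
      S (1 + 1) (fun _ => s) (SchwartzMap.appendTensor (osAdjoint X) Y) := by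
  have happ : Fin.append ((fun _ : Fin 1 => s) ∘ Fin.rev) (fun _ : Fin 1 => s) = fun _ : Fin (1 + 1) => s := by
    funext i
    refine Fin.addCases (fun j => ?_) (fun j => ?_) i
    · exact Fin.append_left _ _ j
    · exact Fin.append_right _ _ j
  rw [h.inner_fieldVec_fieldVec (fun _ => s) (fun _ => s) hX hY (isAppendTensorOf_appendTensor _ _), happ]

/-- **The truncated pairing**: with `ψ_X = Ψ_X − ⟪Ω,Ψ_X⟫Ω`,
`⟪ψ_X, ψ_Y⟫ = 𝔖₂(ΘX* ⊗ Y) − conj 𝔖₁(X) · 𝔖₁(Y)`. [cite: GlimmJaffe1987, §6.1 (truncated functions)] -/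
theorem inner_trunc_trunc (h0 : S.IsNormalized) (s : ι) (X Y : 𝓢((Fin 1 → EuclideanSpace ℝ (Fin d)), ℂ))
    (hX : IsTimeOrdered X) (hY : IsTimeOrdered Y) :
    ⟪h.fieldVec 1 (fun _ => s) X hX - (S 1 (fun _ => s) X) • h.vacuum,
        h.fieldVec 1 (fun _ => s) Y hY - (S 1 (fun _ => s) Y) • h.vacuum⟫_ℂ =
      S (1 + 1) (fun _ => s) (SchwartzMap.appendTensor (osAdjoint X) Y) - conj (S 1 (fun _ => s) X) * S 1 (fun _ => s) Y := by
  have hΩ : ⟪h.vacuum, h.vacuum⟫_ℂ = 1 := by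
    rw [inner_self_eq_norm_sq_to_K, h.norm_vacuum h0]; simp
  have h1 := inner_vacuum_fieldVec h s Y hY
  have h2 : ⟪h.fieldVec 1 (fun _ => s) X hX, h.vacuum⟫_ℂ = conj (S 1 (fun _ => s) X) := by
    rw [← inner_conj_symm, inner_vacuum_fieldVec h s X hX]
  rw [inner_sub_left, inner_sub_right, inner_sub_right, inner_smul_right, inner_smul_right, inner_smul_left,
    inner_smul_left, inner_fieldVec_one_one h s X Y hX hY, h1, h2, hΩ]
  ring

/-- **`𝔖₂(ΘY* ⊗ Y) − 𝔖₁(ΘY*)·𝔖₁(Y) = ‖ψ_Y‖²`** for time-ordered `Y` (hermiticity `𝔖₁(ΘY*) = conj 𝔖₁(Y)` and the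
truncated pairing). [cite: GlimmJaffe1987, §6.1] -/
theorem schwingerTrunc_self_eq_norm_sq (h0 : S.IsNormalized) (hherm : S.IsHermitian) (s : ι)
    (Y : 𝓢((Fin 1 → EuclideanSpace ℝ (Fin d)), ℂ)) (hY : IsTimeOrdered Y) :
    S (1 + 1) (fun _ => s) (SchwartzMap.appendTensor (osAdjoint Y) Y) - S 1 (fun _ => s) (osAdjoint Y) * S 1 (fun _ => s) Y
      = (((‖h.fieldVec 1 (fun _ => s) Y hY - (S 1 (fun _ => s) Y) • h.vacuum‖ ^ 2 : ℝ)) : ℂ) := by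
  have hc : S 1 (fun _ => s) (osAdjoint Y) = conj (S 1 (fun _ => s) Y) := by
    have h1 : S 1 (fun _ => s) Y = conj (S 1 ((fun _ : Fin 1 => s) ∘ Fin.rev) (osAdjoint Y)) := hherm 1 _ Y hY
    rw [h1, Complex.conj_conj]
    rfl
  rw [hc, ← inner_trunc_trunc h h0 s Y Y hY hY, inner_self_eq_norm_sq_to_K, Complex.ofReal_pow]
  rfl

/-- **`e^{-tH} ψ_X = ψ_{X_t}`**: the semigroup translates the truncated vector (`e^{-tH}Ψ_X = Ψ_{X_t}`,
`e^{-tH}Ω = Ω`, and `𝔖₁(X_t) = ⟪Ω, e^{-tH}Ψ_X⟫ = ⟪e^{-tH}Ω, Ψ_X⟫ = 𝔖₁(X)`). [cite: OsterwalderSchraderCMP1973, §4.1] -/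
theorem transfer_trunc (s : ι) (X : 𝓢((Fin 1 → EuclideanSpace ℝ (Fin d)), ℂ)) (hX : IsTimeOrdered X) {t : ℝ}
    (ht : 0 ≤ t) :
    h.transfer t (h.fieldVec 1 (fun _ => s) X hX - (S 1 (fun _ => s) X) • h.vacuum) =
      h.fieldVec 1 (fun _ => s) (translateMulti (timeVec t) X)
          (isTimeOrdered_translateMulti hX (by rw [timeVec_apply_zero]; exact ht)) -
        (S 1 (fun _ => s) (translateMulti (timeVec t) X)) • h.vacuum := by
  have hΩ : h.transfer t h.vacuum = h.vacuum := by
    show h.transfer t (h.genVec (vacGen ι d)) = h.genVec (vacGen ι d)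
    rw [transfer_genVec, timeShiftGen_vacGen]
  have hc : S 1 (fun _ => s) (translateMulti (timeVec t) X) = S 1 (fun _ => s) X := by
    rw [← inner_vacuum_fieldVec h s _ (isTimeOrdered_translateMulti hX (by rw [timeVec_apply_zero]; exact ht)),
      ← h.transfer_fieldVec ht 1 (fun _ => s) X hX, ← h.inner_transfer_left, hΩ, inner_vacuum_fieldVec h s X hX]
  rw [map_sub, map_smul, h.transfer_fieldVec ht, hΩ, hc]

/-- **`ψ_X ≠ 0 ⇒ ψ_{X_t} ≠ 0`** for every `t ≥ 0`: `ψ_{X_t} = e^{-tH}ψ_X`, and `e^{-tH}` is injective — if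
`e^{-tH}ψ = 0` then `⟪ψ, e^{-2tH}ψ⟫ = ‖e^{-tH}ψ‖² = 0`, so the Laplace transform of the (positive, finite) joint spectral
measure `μ_ψ` vanishes at `2t`, forcing `μ_ψ = 0` and `‖ψ‖² = μ_ψ(ℝ^d) = 0`.
[cite: GlimmJaffe1987, Thm. 6.1.3] [cite: ReedSimonI1980, Thm. VIII.12] -/
theorem trunc_translate_ne_zero (s : ι) (X : 𝓢((Fin 1 → EuclideanSpace ℝ (Fin d)), ℂ)) (hX : IsTimeOrdered X)
    (hne : h.fieldVec 1 (fun _ => s) X hX - (S 1 (fun _ => s) X) • h.vacuum ≠ 0) {t : ℝ} (ht : 0 ≤ t) :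
    h.fieldVec 1 (fun _ => s) (translateMulti (timeVec t) X)
        (isTimeOrdered_translateMulti hX (by rw [timeVec_apply_zero]; exact ht)) -
      (S 1 (fun _ => s) (translateMulti (timeVec t) X)) • h.vacuum ≠ 0 := by
  rw [← transfer_trunc h s X hX ht]
  -- a vector orthogonal to its own Euclidean time translate is null
  have key : ∀ (ψ : h.Hilbert) (τ : ℝ), 0 ≤ τ → ⟪ψ, h.transfer τ ψ⟫_ℂ = 0 → ψ = 0 := by
    intro ψ τ hτ h0
    obtain ⟨μ, hμ⟩ := exists_isJointSpectralMeasure_holds h ψ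
    haveI := hμ.isFiniteMeasure
    have hintegrable : Integrable (fun p : EuclideanSpace ℝ (Fin d) => Real.exp (-(τ * p 0))) μ := by
      have hmeas : AEStronglyMeasurable (fun p : EuclideanSpace ℝ (Fin d) => Real.exp (-(τ * p 0))) μ := by
        fun_prop
      refine Integrable.of_bound (C := 1) hmeas ?_
      have hae : ∀ᵐ p ∂μ, ¬ p 0 < 0 := by
        rw [ae_iff]
        simpa using hμ.energy_nonneg
      filter_upwards [hae] with p hp
      rw [Real.norm_eq_abs, abs_of_pos (Real.exp_pos _), Real.exp_le_one_iff, neg_nonpos]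
      exact mul_nonneg hτ (not_lt.1 hp)
    have hint : ∫ p, Real.exp (-(τ * p 0)) ∂μ = 0 := by
      have h1 : ⟪ψ, h.transfer τ ψ⟫_ℂ = ((∫ p, Real.exp (-(τ * p 0)) ∂μ : ℝ) : ℂ) := by
        rw [hμ.inner_transfer h hτ, ← integral_complex_ofReal]
        refine integral_congr_ae (ae_of_all _ fun p => ?_)
        exact (Complex.ofReal_exp _).symm
      rw [h0] at h1
      exact_mod_cast h1.symm
    rw [integral_eq_zero_iff_of_nonneg (fun p => (Real.exp_pos _).le) hintegrable] at hint
    have huniv : μ Set.univ = 0 := by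
      have h2 := ae_iff.1 hint
      have hset : {p : EuclideanSpace ℝ (Fin d) |
          ¬ (fun p : EuclideanSpace ℝ (Fin d) => Real.exp (-(τ * p 0))) p =
            (0 : EuclideanSpace ℝ (Fin d) → ℝ) p} = Set.univ := by
        ext p
        simp [(Real.exp_pos _).ne']
      rwa [hset] at h2
    have hμ0 : μ = 0 := Measure.measure_univ_eq_zero.1 huniv
    have hnorm : ‖ψ‖ ^ 2 = 0 := by
      rw [← hμ.measureReal_univ, hμ0]
      simp
    exact norm_eq_zero.1 (pow_eq_zero_iff two_ne_zero |>.1 hnorm)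
  intro h0
  refine hne (key _ (2 * t) (by positivity) ?_)
  rw [h.inner_transfer_self_eq (by positivity), show 2 * t / 2 = t by ring, h0, norm_zero]
  simp

/-- A real one-point test function supported in positive times, read as the one-point complex test function
`x ↦ w(x 0)` on `(ℝ^d)¹`, is time-ordered. [folklore] -/
theorem isTimeOrdered_one_ofRealTest {w : 𝓢(EuclideanSpace ℝ (Fin d), ℝ)}
    (hw : tsupport (w : EuclideanSpace ℝ (Fin d) → ℝ) ⊆ {y | 0 < y 0}) :
    IsTimeOrdered (SchwartzMap.compCLMOfContinuousLinearEquiv ℂ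
      (ContinuousLinearEquiv.funUnique (Fin 1) ℝ (EuclideanSpace ℝ (Fin d))) (ofRealTest w)) := by
  intro x hx
  have hK : IsClosed ((fun x : Fin 1 → EuclideanSpace ℝ (Fin d) => x 0) ⁻¹'
      tsupport (w : EuclideanSpace ℝ (Fin d) → ℝ)) :=
    (isClosed_tsupport _).preimage (continuous_apply 0)
  have hsub : Function.support
      ((SchwartzMap.compCLMOfContinuousLinearEquiv ℂ
        (ContinuousLinearEquiv.funUnique (Fin 1) ℝ (EuclideanSpace ℝ (Fin d))) (ofRealTest w) :
          𝓢((Fin 1 → EuclideanSpace ℝ (Fin d)), ℂ)) : (Fin 1 → EuclideanSpace ℝ (Fin d)) → ℂ) ⊆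
      (fun x : Fin 1 → EuclideanSpace ℝ (Fin d) => x 0) ⁻¹' tsupport (w : EuclideanSpace ℝ (Fin d) → ℝ) := by
    intro y hy
    rw [Function.mem_support] at hy
    refine subset_tsupport _ (Function.mem_support.2 fun hy0 => hy ?_)
    simp [ofRealTest_apply, hy0]
  have h0 : 0 < x 0 0 := hw (closure_minimal hsub hK hx)
  refine ⟨fun i => by rw [Subsingleton.elim i 0]; exact h0, fun i j hij => ?_⟩
  exact absurd (Subsingleton.elim i j) (ne_of_lt hij)

/-- **Non-triviality gives a real, compactly supported, positive-time `w` with `ψ_w ≠ 0`.**  From the witness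
`𝔖₂(ΘF* ⊗ G) ≠ 𝔖₁(ΘF*)𝔖₁(G)`, i.e. `⟪ψ_F, ψ_G⟫ ≠ 0`: the functional `Y ↦ 𝔖₂(ΘF* ⊗ Y) − 𝔖₁(ΘF*)𝔖₁(Y)` is continuous
and linear, equals `⟪ψ_F, ψ_Y⟫` on time-ordered `Y`, and does not vanish at `G = g_re + i g_im`; so it does not vanish at
one of the real parts, hence (smooth cut-offs converge in `𝒮`) at a compactly supported cut-off `w` of it, and then
`ψ_w ≠ 0`. [cite: GlimmJaffe1987, §6.1] -/
theorem exists_trunc_ne_zero (h0 : S.IsNormalized) (hherm : S.IsHermitian) (s : ι)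
    (hNT : ∃ (F G : 𝓢((Fin 1 → EuclideanSpace ℝ (Fin d)), ℂ)) (H : 𝓢((Fin (1 + 1) → EuclideanSpace ℝ (Fin d)), ℂ)),
      IsTimeOrdered F ∧ IsTimeOrdered G ∧ IsAppendTensorOf H (osAdjoint F) G ∧
        S (1 + 1) (fun _ => s) H ≠ S 1 (fun _ => s) (osAdjoint F) * S 1 (fun _ => s) G) :
    ∃ (w : 𝓢(EuclideanSpace ℝ (Fin d), ℝ)) (hw : tsupport (w : EuclideanSpace ℝ (Fin d) → ℝ) ⊆ {y | 0 < y 0}),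
      HasCompactSupport (w : EuclideanSpace ℝ (Fin d) → ℝ) ∧
        h.fieldVec 1 (fun _ => s) _ (isTimeOrdered_one_ofRealTest hw) -
          (S 1 (fun _ => s) (SchwartzMap.compCLMOfContinuousLinearEquiv ℂ
            (ContinuousLinearEquiv.funUnique (Fin 1) ℝ (EuclideanSpace ℝ (Fin d))) (ofRealTest w))) • h.vacuum ≠ 0 := by
  obtain ⟨F, G, H, hF, hG, hH, hne⟩ := hNT
  set e := ContinuousLinearEquiv.funUnique (Fin 1) ℝ (EuclideanSpace ℝ (Fin d)) with he
  set 𝓧 : 𝓢(EuclideanSpace ℝ (Fin d), ℂ) →L[ℂ] 𝓢((Fin 1 → EuclideanSpace ℝ (Fin d)), ℂ) :=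
    SchwartzMap.compCLMOfContinuousLinearEquiv ℂ e with h𝓧
  have h𝓧_apply : ∀ (f : 𝓢(EuclideanSpace ℝ (Fin d), ℂ)) (x : Fin 1 → EuclideanSpace ℝ (Fin d)),
      𝓧 f x = f (x 0) := fun f x => rfl
  -- the functional `Φ`
  set Φ : 𝓢((Fin 1 → EuclideanSpace ℝ (Fin d)), ℂ) → ℂ := fun Y =>
    S (1 + 1) (fun _ => s) (SchwartzMap.appendTensor (osAdjoint F) Y) -
      S 1 (fun _ => s) (osAdjoint F) * S 1 (fun _ => s) Y with hΦ
  have hΦ_tendsto : ∀ {u : ℕ → 𝓢((Fin 1 → EuclideanSpace ℝ (Fin d)), ℂ)}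
      {Y : 𝓢((Fin 1 → EuclideanSpace ℝ (Fin d)), ℂ)}, Tendsto u atTop (𝓝 Y) →
        Tendsto (fun m => Φ (u m)) atTop (𝓝 (Φ Y)) := by
    intro u Y hu
    have h2 := ((S (1 + 1) (fun _ => s)).continuous.tendsto _).comp
      (SchwartzMap.tendsto_appendTensor (tendsto_const_nhds (x := osAdjoint F)) hu)
    have h1 := ((S 1 (fun _ => s)).continuous.tendsto _).comp hu
    exact h2.sub (h1.const_mul _)
  have hΦ_add : ∀ Y Y', Φ (Y + Y') = Φ Y + Φ Y' := by
    intro Y Y'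
    simp only [hΦ, SchwartzMap.appendTensor_add_right, map_add]
    ring
  have hΦ_smul : ∀ (c : ℂ) Y, Φ (c • Y) = c * Φ Y := by
    intro c Y
    simp only [hΦ, SchwartzMap.appendTensor_smul_right, map_smul, smul_eq_mul]
    ring
  -- `Φ(Y) = ⟪ψ_F, ψ_Y⟫` on time-ordered `Y`
  have hcF : S 1 (fun _ => s) (osAdjoint F) = conj (S 1 (fun _ => s) F) := by
    have h1 : S 1 (fun _ => s) F = conj (S 1 ((fun _ : Fin 1 => s) ∘ Fin.rev) (osAdjoint F)) := hherm 1 _ F hF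
    rw [h1, Complex.conj_conj]
    rfl
  have hΦ_inner : ∀ (Y) (hY : IsTimeOrdered Y),
      Φ Y = ⟪h.fieldVec 1 (fun _ => s) F hF - (S 1 (fun _ => s) F) • h.vacuum,
        h.fieldVec 1 (fun _ => s) Y hY - (S 1 (fun _ => s) Y) • h.vacuum⟫_ℂ := by
    intro Y hY
    rw [inner_trunc_trunc h h0 s F Y hF hY, ← hcF]
  -- `Φ(G) ≠ 0`
  have hHeq : H = SchwartzMap.appendTensor (osAdjoint F) G := by
    ext x; rw [hH x, SchwartzMap.appendTensor_apply]
  have hΦG : Φ G ≠ 0 := by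
    simp only [hΦ, ← hHeq]
    exact sub_ne_zero.2 hne
  -- the one-variable function `g(y) = G(y)` and its real and imaginary parts
  set g : 𝓢(EuclideanSpace ℝ (Fin d), ℂ) := SchwartzMap.compCLMOfContinuousLinearEquiv ℂ e.symm G with hg
  have hg_apply : ∀ y, g y = G (fun _ => y) := fun y => rfl
  have hGg : G = 𝓧 g := by
    ext x
    rw [h𝓧_apply, hg_apply]
    congr 1
    funext i
    rw [Subsingleton.elim i 0]
  set gr : 𝓢(EuclideanSpace ℝ (Fin d), ℝ) := SchwartzMap.postcompCLM Complex.reCLM g with hgr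
  set gi : 𝓢(EuclideanSpace ℝ (Fin d), ℝ) := SchwartzMap.postcompCLM Complex.imCLM g with hgi
  have hg_dec : g = ofRealTest gr + (Complex.I : ℂ) • ofRealTest gi := by
    ext y
    rw [add_apply, smul_apply, ofRealTest_apply, ofRealTest_apply, smul_eq_mul, hgr, hgi,
      SchwartzMap.postcompCLM_apply, SchwartzMap.postcompCLM_apply, Complex.reCLM_apply, Complex.imCLM_apply,
      mul_comm]
    exact (Complex.re_add_im (g y)).symm
  -- supports of the parts
  have htg : tsupport (g : EuclideanSpace ℝ (Fin d) → ℂ) ⊆ {y | 0 < y 0} := by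
    have hK : IsClosed ((fun y : EuclideanSpace ℝ (Fin d) => (fun _ : Fin 1 => y)) ⁻¹'
        tsupport (G : (Fin 1 → EuclideanSpace ℝ (Fin d)) → ℂ)) :=
      (isClosed_tsupport _).preimage (continuous_pi fun _ => continuous_id)
    have hsub : Function.support (g : EuclideanSpace ℝ (Fin d) → ℂ) ⊆
        (fun y : EuclideanSpace ℝ (Fin d) => (fun _ : Fin 1 => y)) ⁻¹'
          tsupport (G : (Fin 1 → EuclideanSpace ℝ (Fin d)) → ℂ) := by
      intro y hy
      rw [Function.mem_support, hg_apply] at hy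
      exact subset_tsupport _ (Function.mem_support.2 hy)
    refine (closure_minimal hsub hK).trans fun y hy => ?_
    exact (hG hy).1 0
  have hparts : ∀ v : 𝓢(EuclideanSpace ℝ (Fin d), ℝ),
      Function.support (v : EuclideanSpace ℝ (Fin d) → ℝ) ⊆ Function.support (g : EuclideanSpace ℝ (Fin d) → ℂ) →
        tsupport (v : EuclideanSpace ℝ (Fin d) → ℝ) ⊆ {y | 0 < y 0} :=
    fun v hv => (closure_mono hv).trans htg
  have htgr : tsupport (gr : EuclideanSpace ℝ (Fin d) → ℝ) ⊆ {y | 0 < y 0} := by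
    refine hparts gr fun y hy hgy => hy ?_
    simp [hgr, SchwartzMap.postcompCLM_apply, hgy]
  have htgi : tsupport (gi : EuclideanSpace ℝ (Fin d) → ℝ) ⊆ {y | 0 < y 0} := by
    refine hparts gi fun y hy hgy => hy ?_
    simp [hgi, SchwartzMap.postcompCLM_apply, hgy]
  -- one of the two real parts carries a non-zero value of `Φ`
  have hsplit : Φ G = Φ (𝓧 (ofRealTest gr)) + Complex.I * Φ (𝓧 (ofRealTest gi)) := by
    rw [hGg, hg_dec, map_add, map_smul, hΦ_add, hΦ_smul]
  obtain ⟨v, hv, hΦv⟩ : ∃ v : 𝓢(EuclideanSpace ℝ (Fin d), ℝ),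
      tsupport (v : EuclideanSpace ℝ (Fin d) → ℝ) ⊆ {y | 0 < y 0} ∧ Φ (𝓧 (ofRealTest v)) ≠ 0 := by
    by_cases hr : Φ (𝓧 (ofRealTest gr)) = 0
    · refine ⟨gi, htgi, fun hi => hΦG ?_⟩
      rw [hsplit, hr, hi, mul_zero, add_zero]
    · exact ⟨gr, htgr, hr⟩
  -- smooth compactly supported cut-offs of `v`
  obtain ⟨u, hu_supp, hu_lim⟩ := exists_tsupport_subset_inter_closedBall_tendsto v
  have hlim : Tendsto (fun m => Φ (𝓧 (ofRealTest (u m)))) atTop (𝓝 (Φ (𝓧 (ofRealTest v)))) :=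
    hΦ_tendsto ((𝓧.continuous.comp ofRealTest.continuous).tendsto v |>.comp hu_lim)
  obtain ⟨m, hm⟩ := (hlim.eventually_ne hΦv).exists
  have hum : tsupport (u m : EuclideanSpace ℝ (Fin d) → ℝ) ⊆ {y | 0 < y 0} :=
    ((hu_supp m).trans Set.inter_subset_left).trans hv
  refine ⟨u m, hum, ?_, fun hzero => hm ?_⟩
  · exact IsCompact.of_isClosed_subset (isCompact_closedBall _ _) (isClosed_tsupport _)
      ((hu_supp m).trans Set.inter_subset_right)
  · rw [hΦ_inner _ (isTimeOrdered_one_ofRealTest hum), hzero, inner_zero_right]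


/-! ## The export for the closing file -/

section Export

variable {ι : Type} {d : ℕ} [NeZero d]

/-- ★★★ **Export: non-triviality ⇒ a real window test function.**  If the OS data `T` are non-trivial at the species
`s`, there is a REAL, compactly supported `w` with `supp w ⊆ {x⁰ > 0}` such that for EVERY time shift `t ≥ 0`, writing
`w_t = τ_t w`, the truncated two-point value `𝔖₂^{ss}(θw_t ⊗ w_t) − 𝔖₁^{s}(θw_t) 𝔖₁^{s}(w_t)` — evaluated on
off-diagonal tensor witnesses of the real pair `(θw_t, w_t)`, exactly the form `IsYangMillsFor` speaks about — has strictly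
positive real part (it equals `‖e^{-tH} ψ_w‖²`, and `e^{-tH}` is injective on the OS Hilbert space).
[cite: GlimmJaffe1987, §6.1, Thm. 6.1.3] -/
theorem exists_realTest_window_data (T : OSData ι d) (s : ι) (hT : T.IsNontrivial s) :
    ∃ w : 𝓢(EuclideanSpace ℝ (Fin d), ℝ), HasCompactSupport (w : EuclideanSpace ℝ (Fin d) → ℝ) ∧
      tsupport (w : EuclideanSpace ℝ (Fin d) → ℝ) ⊆ {y | 0 < y 0} ∧
      ∀ t : ℝ, 0 ≤ t →
        ∃ (F₂ : 𝓢((Fin (1 + 1) → EuclideanSpace ℝ (Fin d)), ℂ)) (A B : 𝓢((Fin 1 → EuclideanSpace ℝ (Fin d)), ℂ)),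
          IsTensorOf F₂ (fun i => ofRealTest (![thetaTest d (timeShiftTest d t w), timeShiftTest d t w] i)) ∧
          IsOffDiagonal F₂ ∧
          IsTensorOf A (fun i => ofRealTest (![thetaTest d (timeShiftTest d t w)] i)) ∧
          IsTensorOf B (fun i => ofRealTest (![timeShiftTest d t w] i)) ∧
          0 < (T.schwinger (1 + 1) (fun _ => s) F₂ -
            T.schwinger 1 (fun _ => s) A * T.schwinger 1 (fun _ => s) B).re := by
  have h : OSReconstructionNoE1 T.schwinger := OSReconstructionNoE1.of_osAxioms T.osAxioms
  obtain ⟨w, hw, hwc, hne⟩ := exists_trunc_ne_zero h T.normalized T.hermitian s hT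
  refine ⟨w, hwc, hw, fun t ht => ?_⟩
  set X : 𝓢((Fin 1 → EuclideanSpace ℝ (Fin d)), ℂ) := SchwartzMap.compCLMOfContinuousLinearEquiv ℂ
      (ContinuousLinearEquiv.funUnique (Fin 1) ℝ (EuclideanSpace ℝ (Fin d))) (ofRealTest w) with hXdef
  have hX : IsTimeOrdered X := isTimeOrdered_one_ofRealTest hw
  have hX_apply : ∀ x : Fin 1 → EuclideanSpace ℝ (Fin d), X x = (w (x 0) : ℂ) := fun x => rfl
  have hY : IsTimeOrdered (translateMulti (timeVec t) X) :=
    isTimeOrdered_translateMulti hX (by rw [timeVec_apply_zero]; exact ht)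
  have hY_apply : ∀ x : Fin 1 → EuclideanSpace ℝ (Fin d),
      translateMulti (timeVec t) X x = (timeShiftTest d t w (x 0) : ℂ) := by
    intro x
    rw [translateMulti_apply, hX_apply, timeShiftTest_apply]
  have hrev : ∀ x : Fin 1 → EuclideanSpace ℝ (Fin d),
      (fun i : Fin 1 => timeReflection d (x (Fin.rev i))) = fun _ => timeReflection d (x 0) := by
    intro x
    funext i
    rw [Subsingleton.elim (Fin.rev i) 0]
  have hneY := trunc_translate_ne_zero h s X hX hne ht
  have hpos : 0 < (T.schwinger (1 + 1) (fun _ => s)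
      (SchwartzMap.appendTensor (osAdjoint (translateMulti (timeVec t) X)) (translateMulti (timeVec t) X)) -
        T.schwinger 1 (fun _ => s) (osAdjoint (translateMulti (timeVec t) X)) *
          T.schwinger 1 (fun _ => s) (translateMulti (timeVec t) X)).re := by
    rw [schwingerTrunc_self_eq_norm_sq h T.normalized T.hermitian s _ hY, Complex.ofReal_re]
    exact pow_pos (norm_pos_iff.2 hneY) 2
  have hB : IsTensorOf (translateMulti (timeVec t) X) (fun i => ofRealTest (![timeShiftTest d t w] i)) := by
    intro x
    simp only [Fin.prod_univ_one, Matrix.cons_val_zero, ofRealTest_apply, hY_apply]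
  have hA : IsTensorOf (osAdjoint (translateMulti (timeVec t) X))
      (fun i => ofRealTest (![thetaTest d (timeShiftTest d t w)] i)) := by
    intro x
    rw [osAdjoint_apply, hrev x, hY_apply]
    simp only [Fin.prod_univ_one, Matrix.cons_val_zero, ofRealTest_apply, Complex.conj_ofReal, thetaTest_apply]
  have hF : IsTensorOf (SchwartzMap.appendTensor (osAdjoint (translateMulti (timeVec t) X)) (translateMulti (timeVec t) X))
      (fun i => ofRealTest (![thetaTest d (timeShiftTest d t w), timeShiftTest d t w] i)) := by
    intro x
    rw [SchwartzMap.appendTensor_apply, hA, hB]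
    simp only [Fin.prod_univ_succ, Fin.prod_univ_zero, Matrix.cons_val_zero,
      Matrix.cons_val_succ, mul_one, Function.comp_apply]
    rfl
  have hoff : IsOffDiagonal
      (SchwartzMap.appendTensor (osAdjoint (translateMulti (timeVec t) X)) (translateMulti (timeVec t) X)) := by
    have h0 : translateMulti (0 : EuclideanSpace ℝ (Fin d)) (osAdjoint (translateMulti (timeVec t) X)) =
        osAdjoint (translateMulti (timeVec t) X) := by
      ext x
      simp [translateMulti_apply]
    have h1 := isOffDiagonal_appendTensor_translateMulti_osAdjoint hY hY (b := (0 : EuclideanSpace ℝ (Fin d)))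
      (by simp)
    rwa [h0] at h1
  exact ⟨_, _, _, hF, hoff, hA, hB, hpos⟩

end Export

end Summit.QuantumFields.YangMills.Theorems.WindowFromNontriviality

end
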